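import Summits.Ventures.YMGap.RobustBall.MassGapOnBallZdGRows
import Summits.Ventures.YMGap.RobustBall.TorusRowsSU3Star
import HarnessLib

/-!
# Venture YMGap, track ROBUST-BALL (Y2) — crux Y2-X2-Zd, step 7: HYPOTHESIS-FREE `SU(N)` / `SU(3)` rows (`d = 4`)
# and `SU(2)`, `d = 3` rows of the mass gap on the gauge-invariant `ℤ^d` ball through the robust star door

HONEST FRAMING. WHAT THIS IS: a venture file (cell `pub-ymgap`, track Y2 ROBUST-BALL, seat ds-2): NUMERIC ROWS of
`massGapOnBallZdG_of_robustStar` (`RobustStarDoorZd.lean`), with the certificates of the torus star rows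
`TorusRowsSU3Star.lean` / `TorusRowsSU2Star.lean` VERBATIM (same hypotheses), now concluding the `ℤ^d` MASS GAP
(unique DLR state + Shen–Zhu–Zhu clustering, `PerturbedMassGapAt`) uniformly on the gauge-invariant tier-1 `ℤ^d` ball
`MemBallZdG (2ε) ε R` (any range `R`):
* `SU(N)`, `d = 4`, EVERY `N ≥ 2`, HYPOTHESIS-FREE on p2's eigen modulus (`OneLinkEigen.oneLinkKRModulus_eigen`):
  schema `suN_massGapOnBallZdG_star_eigen` ('t Hooft coupling `β_W/N²`); `SU(3)` rows
  `(β_W, ε) = (1/8, 37/250), (1/6, 13/125), (1/5, 69/1000), (1/4, 19/1000)` — no H1/H2;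
* `SU(2)`, `d = 3` (quarter modulus): schema `su2_massGapOnBallZdG_dim3_star`; rows
  `(β_W, ε) = (1/4, 57/500), (3/10, 9/100), (2/5, 1/20), (1/2, 17/1000)` — the infinite-volume `ℤ³` companions of
  Y4's torus receiving rows.
WHAT THIS IS NOT: every radius is an artefact of the door; strong-coupling LATTICE statements — nothing about the
continuum limit or the Millennium problem; tier 2 (infinite range) is not touched.

## References
* The tree: `RobustBall/RobustStarDoorZd.lean`, `RobustBall/TorusRowsSU3Star.lean` and `TorusRowsSU2Star.lean` (g7:
  schemas and certificates, followed line by line), `Thresholds/OneLinkEigenModulus.lean` (p2).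
-/

noncomputable section

open Literature.MathematicalPhysics.QuantumFieldTheory.Balaban1983to89.StrongCouplingDobrushinWindow
  (OneLinkKRModulus)
open Summit.Ventures.YMGap.StarResolventDim (Delta gaugeR doorPoly gaugeR_lt_one_of_door)

namespace Summit.Ventures.YMGap.RobustBall

/-! ### `SU(N)`, `d = 4`: the hypothesis-free schema on the eigen modulus -/

/-- **SCHEMA, `SU(N)` (`N ≥ 2`), `d = 4`, HYPOTHESIS-FREE: the mass gap on the whole gauge-invariant tier-1 `ℤ⁴` ball
`MemBallZdG ε₀ ε₁ R` at 't Hooft coupling `β_W/N²` (tree coupling `β_W/N`) through the ROBUST STAR DOOR on p2's eigen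
modulus** at radius `6β_W/N² < 1/2` (`K₁ = (N²/(N²−1))(1/2+2R)/(1/2−R)`, a decimal majorant `Kb` of it):
`MassGapOnBallZdG 4 N (β_W/N²) ε₀ ε₁ R`. [folklore] -/
theorem suN_massGapOnBallZdG_star_eigen (Kn : ℕ) {N : ℕ} (hN : 2 ≤ N) {βW ε₀ ε₁ c lam E S Kb : ℝ}
    (hβ0 : 0 ≤ βW) (hR : βW / (N : ℝ) ^ 2 * 6 < 1 / 2) (hε₁ : 0 ≤ ε₁) (hE : Real.exp ε₀ ≤ E)
    (hS : Real.sqrt N ≤ S) (hKb : (N : ℝ) ^ 2 / ((N : ℝ) ^ 2 - 1) * ((1 / 2 + 2 * (βW / (N : ℝ) ^ 2 * 6)) /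
      (1 / 2 - βW / (N : ℝ) ^ 2 * 6)) ≤ Kb)
    (hc : Kb * E * (1 + 2 * S * ε₁) * (βW / (N : ℝ) ^ 2) ≤ c) (hlam : S * ε₁ ≤ lam) (hθ1 : 6 * c + lam < 1)
    (hcd : doorPoly 4 c < 1) (hρ1 : gaugeR 4 c + (lam + (6 * c + lam) ^ Kn * (16 * lam)) / (1 - (6 * c + lam)) < 1)
    (R : ℕ) : MassGapOnBallZdG 4 N (βW / (N : ℝ) ^ 2) ε₀ ε₁ R := by
  have hN1 : 1 ≤ N := by omega
  have hNpos : (0 : ℝ) < N := by exact_mod_cast (show 0 < N by omega)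
  have hN2 : (2 : ℝ) ≤ N := by exact_mod_cast hN
  set Rm : ℝ := βW / (N : ℝ) ^ 2 * 6 with hRdef
  set K : ℝ := (N : ℝ) ^ 2 / ((N : ℝ) ^ 2 - 1) * ((1 / 2 + 2 * Rm) / (1 / 2 - Rm)) with hKdef
  have hmod : OneLinkKRModulus N Rm K := OneLinkEigen.oneLinkKRModulus_eigen hN hR
  have hK0 : 0 ≤ K := by
    have h1 : (0 : ℝ) < (N : ℝ) ^ 2 - 1 := by nlinarith
    have h2 : (0 : ℝ) < 1 / 2 - Rm := by linarith
    positivity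
  have hS0 : 0 ≤ S := (Real.sqrt_nonneg _).trans hS
  have hE0 : 0 ≤ E := (Real.exp_pos _).le.trans hE
  have hKb0 : 0 ≤ Kb := hK0.trans hKb
  set θ : ℝ := 6 * c + lam with hθ
  set ρ : ℝ := gaugeR 4 c + (lam + θ ^ Kn * (16 * lam)) / (1 - θ) with hρ
  have habs : |(N : ℝ) * (βW / (N : ℝ) ^ 2)| / (N : ℝ) = βW / (N : ℝ) ^ 2 := by
    rw [abs_of_nonneg (by positivity)]
    field_simp
  have hR' : |(N : ℝ) * (βW / (N : ℝ) ^ 2)| / (N : ℝ) * (2 * (((4 : ℕ) : ℝ) - 1)) ≤ Rm := by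
    rw [habs, hRdef]; norm_num
  have hc' : K * Real.exp ε₀ * (1 + 2 * Real.sqrt N * ε₁) * (|(N : ℝ) * (βW / (N : ℝ) ^ 2)| / (N : ℝ)) ≤ c := by
    refine le_trans ?_ hc
    rw [habs]
    have hb : 0 ≤ βW / (N : ℝ) ^ 2 := by positivity
    have h2 : 1 + 2 * Real.sqrt N * ε₁ ≤ 1 + 2 * S * ε₁ := by nlinarith
    have h3 : 0 ≤ 1 + 2 * Real.sqrt N * ε₁ := by positivity
    calc K * Real.exp ε₀ * (1 + 2 * Real.sqrt N * ε₁) * (βW / (N : ℝ) ^ 2)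
        ≤ Kb * E * (1 + 2 * Real.sqrt N * ε₁) * (βW / (N : ℝ) ^ 2) := by gcongr
      _ ≤ Kb * E * (1 + 2 * S * ε₁) * (βW / (N : ℝ) ^ 2) := by gcongr
  have hlam' : Real.sqrt N * ε₁ ≤ lam := le_trans (mul_le_mul_of_nonneg_right hS hε₁) hlam
  have hθ' : θ = (2 * ((4 : ℕ) : ℝ) - 2) * c + lam := by rw [hθ]; push_cast; ring
  have hρ' : ρ = gaugeR 4 c + (lam + θ ^ Kn * (4 * ((4 : ℕ) : ℝ) * lam)) / (1 - θ) := by rw [hρ]; push_cast; ring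
  exact massGapOnBallZdG_of_robustStar (d := 4) (N := N) (by norm_num) hN1 hK0 hR' hmod hε₁ hc' hlam' hθ' hθ1 hcd
    hρ' hρ1

/-! ### `SU(3)`, `d = 4` rows (hypothesis-free) -/

/-- **ROW `(β_W, ε) = (1 / 8, 37 / 250)`, `SU(3)`, `d = 4`, ROBUST STAR DOOR ON `ℤ⁴`, eigen modulus** (`K₁ = 9/5`;
certificate `c = 10169 / 200000`, `λ = 51269 / 200000`): `MemBallZdG (37/125) (37/250) R` has the mass gap at 't
Hooft coupling `1 / 72`; HYPOTHESIS-FREE (no H1/H2). [folklore] -/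
theorem su3_massGapOnBallZdG_star_oneEighth (R : ℕ) : MassGapOnBallZdG 4 3 (1 / 72) (37 / 125) (37 / 250) R := by
  have e1 : (1 / 8 : ℝ) / ((3 : ℕ) : ℝ) ^ 2 = 1 / 72 := by norm_num
  have hS : Real.sqrt ((3 : ℕ) : ℝ) ≤ 1.73206 := by
    have : ((3 : ℕ) : ℝ) = 3 := by norm_num
    rw [this]; exact sqrt_three_le
  have h := suN_massGapOnBallZdG_star_eigen 20 (N := 3) (by norm_num) (βW := 1 / 8) (ε₀ := 37 / 125)
    (ε₁ := 37 / 250) (c := 10169 / 200000) (lam := 51269 / 200000) (E := 1344473 / 1000000) (S := 1.73206) (Kb := 9 / 5)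
    (by norm_num) (by norm_num) (by norm_num) exp_le_37_125_star hS (by norm_num) (by norm_num) (by norm_num) (by norm_num)
    (by unfold doorPoly; norm_num) (by unfold gaugeR Delta; norm_num) R
  rw [e1] at h
  exact h

/-- **ROW `(β_W, ε) = (1 / 6, 13 / 125)`, `SU(3)`, `d = 4`, ROBUST STAR DOOR ON `ℤ⁴`, eigen modulus** (`K₁ = 117/56`;
certificate `c = 64799 / 1000000`, `λ = 36027 / 200000`): 't Hooft coupling `1 / 54`; HYPOTHESIS-FREE. [folklore] -/
theorem su3_massGapOnBallZdG_star_oneSixth (R : ℕ) : MassGapOnBallZdG 4 3 (1 / 54) (26 / 125) (13 / 125) R := by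
  have e1 : (1 / 6 : ℝ) / ((3 : ℕ) : ℝ) ^ 2 = 1 / 54 := by norm_num
  have hS : Real.sqrt ((3 : ℕ) : ℝ) ≤ 1.73206 := by
    have : ((3 : ℕ) : ℝ) = 3 := by norm_num
    rw [this]; exact sqrt_three_le
  have h := suN_massGapOnBallZdG_star_eigen 20 (N := 3) (by norm_num) (βW := 1 / 6) (ε₀ := 26 / 125)
    (ε₁ := 13 / 125) (c := 64799 / 1000000) (lam := 36027 / 200000) (E := 615607 / 500000) (S := 1.73206) (Kb := 117 / 56)
    (by norm_num) (by norm_num) (by norm_num) exp_le_26_125_star3 hS (by norm_num) (by norm_num) (by norm_num) (by norm_num)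
    (by unfold doorPoly; norm_num) (by unfold gaugeR Delta; norm_num) R
  rw [e1] at h
  exact h

/-- **ROW `(β_W, ε) = (1 / 5, 69 / 1000)`, `SU(3)`, `d = 4`, ROBUST STAR DOOR ON `ℤ⁴`, eigen modulus** (`K₁ = 207/88`;
certificate `c = 4647 / 62500`, `λ = 119513 / 1000000`): 't Hooft coupling `1 / 45`; HYPOTHESIS-FREE. [folklore] -/
theorem su3_massGapOnBallZdG_star_oneFifth (R : ℕ) : MassGapOnBallZdG 4 3 (1 / 45) (69 / 500) (69 / 1000) R := by
  have e1 : (1 / 5 : ℝ) / ((3 : ℕ) : ℝ) ^ 2 = 1 / 45 := by norm_num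
  have hS : Real.sqrt ((3 : ℕ) : ℝ) ≤ 1.73206 := by
    have : ((3 : ℕ) : ℝ) = 3 := by norm_num
    rw [this]; exact sqrt_three_le
  have h := suN_massGapOnBallZdG_star_eigen 20 (N := 3) (by norm_num) (βW := 1 / 5) (ε₀ := 69 / 500)
    (ε₁ := 69 / 1000) (c := 4647 / 62500) (lam := 119513 / 1000000) (E := 143497 / 125000) (S := 1.73206) (Kb := 207 / 88)
    (by norm_num) (by norm_num) (by norm_num) exp_le_69_500_star3 hS (by norm_num) (by norm_num) (by norm_num) (by norm_num)
    (by unfold doorPoly; norm_num) (by unfold gaugeR Delta; norm_num) R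
  rw [e1] at h
  exact h

/-- **ROW `(β_W, ε) = (1 / 4, 19 / 1000)`, `SU(3)`, `d = 4`, ROBUST STAR DOOR ON `ℤ⁴`, eigen modulus** (`K₁ = 45/16`;
certificate `c = 86493 / 1000000`, `λ = 3291 / 100000`): 't Hooft coupling `1 / 36`; HYPOTHESIS-FREE. [folklore] -/
theorem su3_massGapOnBallZdG_star_oneQuarter (R : ℕ) : MassGapOnBallZdG 4 3 (1 / 36) (19 / 500) (19 / 1000) R := by
  have e1 : (1 / 4 : ℝ) / ((3 : ℕ) : ℝ) ^ 2 = 1 / 36 := by norm_num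
  have hS : Real.sqrt ((3 : ℕ) : ℝ) ≤ 1.73206 := by
    have : ((3 : ℕ) : ℝ) = 3 := by norm_num
    rw [this]; exact sqrt_three_le
  have h := suN_massGapOnBallZdG_star_eigen 20 (N := 3) (by norm_num) (βW := 1 / 4) (ε₀ := 19 / 500)
    (ε₁ := 19 / 1000) (c := 86493 / 1000000) (lam := 3291 / 100000) (E := 259683 / 250000) (S := 1.73206) (Kb := 45 / 16)
    (by norm_num) (by norm_num) (by norm_num) exp_le_19_500_star3 hS (by norm_num) (by norm_num) (by norm_num) (by norm_num)
    (by unfold doorPoly; norm_num) (by unfold gaugeR Delta; norm_num) R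
  rw [e1] at h
  exact h

/-! ### `SU(2)`, `d = 3`: the schema on the quarter modulus and four rows (infinite-volume `ℤ³`) -/

/-- **SCHEMA, `SU(2)`, `d = 3`: the mass gap on the whole gauge-invariant tier-1 `ℤ³` ball `MemBallZdG ε₀ ε₁ R` at
't Hooft coupling `β_W/4` through the ROBUST STAR DOOR** on the quarter modulus (`0 < β_W ≤ 2/3`; door
`doorPoly 3 c < 1`, `θ = 4c + λ`, `gaugeR 3 c + (λ + θ^K·12λ)/(1−θ) < 1`): `MassGapOnBallZdG 3 2 (β_W/4) ε₀ ε₁ R` — the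
infinite-volume `ℤ³` companion of Y4's torus receiving rows. [folklore] -/
theorem su2_massGapOnBallZdG_dim3_star (Kn : ℕ) {βW ε₀ ε₁ c lam E S : ℝ} (hβ0 : 0 ≤ βW) (hβ : βW ≤ 2 / 3)
    (hε₁ : 0 ≤ ε₁) (hE : Real.exp ε₀ ≤ E) (hS : Real.sqrt 2 ≤ S) (hc : E * (1 + 2 * S * ε₁) * (βW / 4) ≤ c)
    (hlam : S * ε₁ ≤ lam) (hθ1 : 4 * c + lam < 1) (hcd : doorPoly 3 c < 1)
    (hρ1 : gaugeR 3 c + (lam + (4 * c + lam) ^ Kn * (12 * lam)) / (1 - (4 * c + lam)) < 1) (R : ℕ) :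
    MassGapOnBallZdG 3 2 (βW / 4) ε₀ ε₁ R := by
  have hS0 : 0 ≤ S := (Real.sqrt_nonneg _).trans hS
  have hE0 : 0 ≤ E := (Real.exp_pos _).le.trans hE
  set θ : ℝ := 4 * c + lam with hθ
  set ρ : ℝ := gaugeR 3 c + (lam + θ ^ Kn * (12 * lam)) / (1 - θ) with hρ
  have habs : |((2 : ℕ) : ℝ) * (βW / 4)| / ((2 : ℕ) : ℝ) = βW / 4 := by
    rw [abs_of_nonneg (by positivity)]
    push_cast
    ring
  have hR : |((2 : ℕ) : ℝ) * (βW / 4)| / ((2 : ℕ) : ℝ) * (2 * (((3 : ℕ) : ℝ) - 1)) ≤ 3 * βW / 2 := by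
    rw [habs]; push_cast; linarith
  have hc' : (1 : ℝ) * Real.exp ε₀ * (1 + 2 * Real.sqrt ((2 : ℕ) : ℝ) * ε₁) *
      (|((2 : ℕ) : ℝ) * (βW / 4)| / ((2 : ℕ) : ℝ)) ≤ c := by
    refine le_trans ?_ hc
    have h1 : Real.sqrt ((2 : ℕ) : ℝ) = Real.sqrt 2 := by norm_num
    rw [h1, one_mul, habs]
    have hb : 0 ≤ βW / 4 := by positivity
    calc Real.exp ε₀ * (1 + 2 * Real.sqrt 2 * ε₁) * (βW / 4) ≤ E * (1 + 2 * Real.sqrt 2 * ε₁) * (βW / 4) := by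
          gcongr
      _ ≤ E * (1 + 2 * S * ε₁) * (βW / 4) := by gcongr
  have hlam' : Real.sqrt ((2 : ℕ) : ℝ) * ε₁ ≤ lam := by
    have h1 : Real.sqrt ((2 : ℕ) : ℝ) = Real.sqrt 2 := by norm_num
    rw [h1]; exact le_trans (mul_le_mul_of_nonneg_right hS hε₁) hlam
  have hθ' : θ = (2 * ((3 : ℕ) : ℝ) - 2) * c + lam := by rw [hθ]; push_cast; ring
  have hρ' : ρ = gaugeR 3 c + (lam + θ ^ Kn * (4 * ((3 : ℕ) : ℝ) * lam)) / (1 - θ) := by rw [hρ]; push_cast; ring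
  exact massGapOnBallZdG_of_robustStar (d := 3) (N := 2) (by norm_num) (by norm_num) zero_le_one hR
    (su2_quarterModulus hβ) hε₁ hc' hlam' hθ' hθ1 hcd hρ' hρ1

/-- **ROW `(β_W, ε) = (1 / 4, 57 / 500)`, `SU(2)`, `d = 3`, ROBUST STAR DOOR ON `ℤ³`** (certificate
`c = 103819 / 1000000`, `λ = 80611 / 500000`): `MemBallZdG (57/250) (57/500) R`, 't Hooft coupling `1 / 16`;
HYPOTHESIS-FREE. [folklore] -/
theorem su2_massGapOnBallZdG_dim3_star_oneQuarter (R : ℕ) : MassGapOnBallZdG 3 2 (1 / 16) (57 / 250) (57 / 500) R := by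
  have e1 : (1 / 4 : ℝ) / 4 = 1 / 16 := by norm_num
  have h := su2_massGapOnBallZdG_dim3_star 20 (βW := 1 / 4) (ε₀ := 57 / 250) (ε₁ := 57 / 500)
    (c := 103819 / 1000000) (lam := 80611 / 500000) (by norm_num) (by norm_num) (by norm_num) exp_le_57_250_star
    sqrt_two_le (by norm_num) (by norm_num) (by norm_num) (by unfold doorPoly; norm_num)
    (by unfold gaugeR Delta; norm_num) R
  rw [e1] at h
  exact h

/-- **ROW `(β_W, ε) = (3 / 10, 9 / 100)`, `SU(2)`, `d = 3`, ROBUST STAR DOOR ON `ℤ³`** (certificate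
`c = 112649 / 1000000`, `λ = 1591 / 12500`): 't Hooft coupling `3 / 40`; HYPOTHESIS-FREE. [folklore] -/
theorem su2_massGapOnBallZdG_dim3_star_threeTenths (R : ℕ) : MassGapOnBallZdG 3 2 (3 / 40) (9 / 50) (9 / 100) R := by
  have e1 : (3 / 10 : ℝ) / 4 = 3 / 40 := by norm_num
  have h := su2_massGapOnBallZdG_dim3_star 20 (βW := 3 / 10) (ε₀ := 9 / 50) (ε₁ := 9 / 100)
    (c := 112649 / 1000000) (lam := 1591 / 12500) (by norm_num) (by norm_num) (by norm_num) exp_le_9_50_star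
    sqrt_two_le (by norm_num) (by norm_num) (by norm_num) (by unfold doorPoly; norm_num)
    (by unfold gaugeR Delta; norm_num) R
  rw [e1] at h
  exact h

/-- **ROW `(β_W, ε) = (2 / 5, 1 / 20)`, `SU(2)`, `d = 3`, ROBUST STAR DOOR ON `ℤ³`** (certificate
`c = 126147 / 1000000`, `λ = 70711 / 1000000`): 't Hooft coupling `1 / 10`; HYPOTHESIS-FREE. [folklore] -/
theorem su2_massGapOnBallZdG_dim3_star_twoFifths (R : ℕ) : MassGapOnBallZdG 3 2 (1 / 10) (1 / 10) (1 / 20) R := by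
  have e1 : (2 / 5 : ℝ) / 4 = 1 / 10 := by norm_num
  have h := su2_massGapOnBallZdG_dim3_star 20 (βW := 2 / 5) (ε₀ := 1 / 10) (ε₁ := 1 / 20)
    (c := 126147 / 1000000) (lam := 70711 / 1000000) (by norm_num) (by norm_num) (by norm_num) exp_le_1_10_star
    sqrt_two_le (by norm_num) (by norm_num) (by norm_num) (by unfold doorPoly; norm_num)
    (by unfold gaugeR Delta; norm_num) R
  rw [e1] at h
  exact h

/-- **ROW `(β_W, ε) = (1 / 2, 17 / 1000)`, `SU(2)`, `d = 3`, ROBUST STAR DOOR ON `ℤ³`** (certificate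
`c = 67771 / 500000`, `λ = 12021 / 500000`): 't Hooft coupling `1 / 8`; HYPOTHESIS-FREE. [folklore] -/
theorem su2_massGapOnBallZdG_dim3_star_oneHalf (R : ℕ) : MassGapOnBallZdG 3 2 (1 / 8) (17 / 500) (17 / 1000) R := by
  have e1 : (1 / 2 : ℝ) / 4 = 1 / 8 := by norm_num
  have h := su2_massGapOnBallZdG_dim3_star 20 (βW := 1 / 2) (ε₀ := 17 / 500) (ε₁ := 17 / 1000)
    (c := 67771 / 500000) (lam := 12021 / 500000) (by norm_num) (by norm_num) (by norm_num) exp_le_17_500_star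
    sqrt_two_le (by norm_num) (by norm_num) (by norm_num) (by unfold doorPoly; norm_num)
    (by unfold gaugeR Delta; norm_num) R
  rw [e1] at h
  exact h

end Summit.Ventures.YMGap.RobustBall

end
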